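import Summits.NavierStokesRegularity.FluidComputer.BlockPairStall
import Summits.NavierStokesRegularity.FluidComputer.BlockPairSupport
import Summits.NavierStokesRegularity.FluidComputer.BlockReachVoid

/-!
# The pinned two-mode field is the viscously damped gate: no reach certificate on ANY open
working region below the viscous threshold (bp3 gen 36, ASSEMBLY §2g.9(s))

Block (wavelet-pair) line of the `pub-fluidc` cell. HONEST FRAMING: low prior, high
value-of-information experiment on Tao's machine paradigm; NOT a claim that NS blows up. Everything
here is [folklore] mathematics ABOUT the re-typed local layer (`OpenReachBound` +
`ReachCertificate`, ASKs 95–101) and the two-mode Galerkin truncation of the wavelet pair; the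
whole-tick residue `OpenIdeaBound` (ASK 91) is untouched. Nothing is discharged; not evidence
about NS in either direction.

WHAT `BlockReachVoid` (ASK 101) LEFT OPEN. On an open region containing an input AND an output RAY
the instantaneous residue and a reach certificate contradict for every design field
(`no_certificate`). PRECISION: a certificate from `AinO P` forces `AinO P ⊆ U` (`Tube_zero`,
`Tube_sub`), so `U` always contains the input ray `{(A, 0) : aLo ≤ A}` and is UNBOUNDED in the
input amplitude; what ASK 101 leaves are the open `U ⊇ AinO P` WITHOUT an output ray. On every
open `U` the rigidity of ASK 98 pins `F` within `ε` of the two-mode Galerkin–Navier–Stokes field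
`unit n • nsVF n` (`OpenReachBound.norm_unit_smul_nsVF_sub_le` needs NO rays), so the standard
falsifier of R1-DESIGN §24.15(2) runs with the exact two-mode orbit from the clean admissible input
`(aLo, 0)`: can it reach output amplitude `aLo` within the tick? This file gives the first
NECESSARY condition, uniform in `U`. The literal re-typing (β″₁) of R1-DESIGN §24.15 (windows AND
working region bounded in BOTH amplitudes) is NOT typed in this lane; see READING.

* §1 `viscRate_le_viscRate_succ` — `Λ_n ≤ Λ_{n+1}` (the band-limits `2ⁿ < |ξ| ≤ (3/2)·2ⁿ`).
* §2 `backCoef_eq_zero` — the BACKSCATTER coefficient `κ'_n = Re⟨B(ψ_{n+1},ψ_{n+1}),ψ_n⟩`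
  VANISHES for every admissible design (frequency bookkeeping, `BlockPairSupport`);
  `smul_nsVF_eq_pairVF` — for every clock `υ`, `υ • nsVF n` IS the pair field
  `pairVF (υΛ_n) (υΛ_{n+1}) η (υ E_n κ_n/√E_{n+1}) (υ √E_n κ'_n)` of `BlockPairStall` (the closed
  form `nsVF_eq` of ASK 99, regrouped), hence (`smul_nsVF_eq_pairVF_zero`) the VISCOUSLY DAMPED
  GATE `pairVF (υΛ_n) (υΛ_{n+1}) η (υ E_n κ_n/√E_{n+1}) 0`: the lane's quadratic gate plus the
  two dissipation terms, nothing else.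
* §3 `nsVF_orbit_snd_lt_of_subcritical` — along every exact orbit of `υ • nsVF n` (`υ > 0`) from
  a clean input `(A₀, 0)`, `A₀ > 0`, of a design with `κ_n > 0`: if the block is SUBCRITICAL,
  `E_n κ_n A₀ ≤ √E_{n+1} Λ_{n+1}`, the output amplitude stays strictly below `A₀` for all times
  (the viscous ceiling `pair_snd_lt_of_subcritical`; `υ` cancels).
* §4 `OpenReachBound.no_certificate_of_subcritical` — an inhabited residue on ANY open `U`, a
  reach certificate `ReachCertificate F U ε 1 (AinO P) (AoutO P)` and an exact orbit of
  `unit n • nsVF n` from `(aLo, 0)` over one tick cannot coexist at a subcritical block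
  `E_n κ_n aLo ≤ √E_{n+1} Λ_{n+1}`: the orbit is certified (ASK 101 §1) to reach output
  amplitude `≥ aLo`, and cannot (§3).

READING (honest). For the PRESENT typing (open windows `AinO`/`AoutO`, instantaneous residue on
an open `U`): below the viscous threshold nothing survives on any open `U`, output ray or not. For
the OWED re-typing (β″₁) — not typed here — the condition is INHERITED by any version whose residue
pins `F` within `ε` of `unit n • nsVF n` near the pinned orbit and whose hand-off asks output
amplitude `≥ aLo` from the clean input `(aLo, 0)` (§3 is typing-independent); that is an inference
about an untyped statement, recorded as such. Either way a NECESSARY condition, not a sufficient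
one and not a selection rule: every block must be SUPERCRITICAL,
`Re_n := E_n κ_n aLo/(√E_{n+1} Λ_{n+1}) > 1`.
With `E_n = E₀ηⁿ`, `κ_n = 2^{5n/2} κ₀`, `Λ_n = 4ⁿ Λ₀` this is `Re_n = Re₀ (√(2η))ⁿ`
(`Re₀ = √E₀ κ₀ aLo/(4 √η Λ₀)`): constant along the cascade exactly at the Navier–Stokes
corner `η = 1/2` and growing for `η > 1/2`, so it is ONE inequality on `(E₀, κ₀, Λ₀, aLo)`. The
hypothesis of §4 is satisfiable (small `E₀`), so the theorem is not vacuous; whether a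
supercritical block DOES hand off in time `≤ 1` with the tolerances of `AoutO` is the open design
question (β″₁) proper. The v8.74 "backscatter selection rule" is WITHDRAWN: `κ'_n ≡ 0` (§2).
The exact orbit is a HYPOTHESIS of §4 (global existence of the planar polynomial flow is
[folklore] — energy bound `pair_energy_le` + Picard–Lindelöf — and not formalised here).
[cite: Tao2016AveragedNS, §1.3 pp. 10–11]
-/

noncomputable section

open MeasureTheory Set Filter Topology Metric
open scoped ENNReal NNReal

namespace Summit.NavierStokesRegularity.FluidComputer

open Literature.Analysis.FluidPDE Literature.Analysis.FluidPDE.Tao2016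
open Literature.Analysis.FluidPDE.FluidComputer
open Summit.NavierStokesRegularity.NavierStokesRegularity.Theorems.FluidComputer

namespace BlockDesign

/-! ### §1. The viscous rates increase along the cascade -/

section Visc

variable (𝒟 : CascadeWaveletData 1 1)

/-- `Λ_n ≤ 4π² ((3/2) 2ⁿ)²`: `ψ̂_n` is supported in `|ξ| ≤ (3/2) 2ⁿ` and `∫ |ψ̂_n|² = 1`.
[cite: Tao2016AveragedNS, §4 p. 21] -/
theorem viscRate_le (n : ℕ) : viscRate 𝒟 n ≤ 4 * Real.pi ^ 2 * ((2 : ℝ) ^ n * (3 / 2)) ^ 2 := by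
  have hle : ∀ᵐ ξ ∂(volume : Measure (EuclideanSpace ℝ (Fin 3))),
      heatRate ξ * modeWeight 𝒟 0 (n : ℤ) ξ ≤
        4 * Real.pi ^ 2 * ((2 : ℝ) ^ n * (3 / 2)) ^ 2 * modeWeight 𝒟 0 (n : ℤ) ξ := by
    filter_upwards [𝒟.fourierFn_cascadeWavelet_eq_zero two_pos' 0 (n : ℤ)] with ξ hξ
    by_cases hmem : ξ ∈ freqRegion 𝒟 0 (n : ℤ)
    · have h1 : ‖ξ‖ ≤ (2 : ℝ) ^ n * (3 / 2) := (norm_of_mem_region 𝒟 n hmem).2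
      have h2 : heatRate ξ ≤ 4 * Real.pi ^ 2 * ((2 : ℝ) ^ n * (3 / 2)) ^ 2 := by
        unfold heatRate
        have : ‖ξ‖ ^ 2 ≤ ((2 : ℝ) ^ n * (3 / 2)) ^ 2 := pow_le_pow_left₀ (norm_nonneg ξ) h1 2
        nlinarith [sq_nonneg Real.pi]
      exact mul_le_mul_of_nonneg_right h2 (modeWeight_nonneg ξ)
    · have h0 : modeWeight 𝒟 0 (n : ℤ) ξ = 0 := by simp [modeWeight, hξ hmem]
      simp [h0]
  calc viscRate 𝒟 n ≤ ∫ ξ, 4 * Real.pi ^ 2 * ((2 : ℝ) ^ n * (3 / 2)) ^ 2 *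
        modeWeight 𝒟 0 (n : ℤ) ξ :=
        integral_mono_ae (integrable_heatRate_mul_modeWeight two_pos')
          ((integrable_modeWeight).const_mul _) hle
    _ = 4 * Real.pi ^ 2 * ((2 : ℝ) ^ n * (3 / 2)) ^ 2 := by
        rw [integral_const_mul, integral_modeWeight two_pos', mul_one]

/-- `4π² 4ⁿ ≤ Λ_n`: `ψ̂_n` is supported in `|ξ| > 2ⁿ`. [cite: Tao2016AveragedNS, §4 p. 21] -/
theorem sq_le_viscRate (n : ℕ) : 4 * Real.pi ^ 2 * ((2 : ℝ) ^ n) ^ 2 ≤ viscRate 𝒟 n := by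
  have hle : ∀ᵐ ξ ∂(volume : Measure (EuclideanSpace ℝ (Fin 3))),
      4 * Real.pi ^ 2 * ((2 : ℝ) ^ n) ^ 2 * modeWeight 𝒟 0 (n : ℤ) ξ ≤
        heatRate ξ * modeWeight 𝒟 0 (n : ℤ) ξ := by
    filter_upwards [𝒟.fourierFn_cascadeWavelet_eq_zero two_pos' 0 (n : ℤ)] with ξ hξ
    by_cases hmem : ξ ∈ freqRegion 𝒟 0 (n : ℤ)
    · have h1 : (2 : ℝ) ^ n ≤ ‖ξ‖ := (norm_of_mem_region 𝒟 n hmem).1.le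
      have h2 : 4 * Real.pi ^ 2 * ((2 : ℝ) ^ n) ^ 2 ≤ heatRate ξ := by
        unfold heatRate
        have : ((2 : ℝ) ^ n) ^ 2 ≤ ‖ξ‖ ^ 2 := pow_le_pow_left₀ (by positivity) h1 2
        nlinarith [sq_nonneg Real.pi]
      exact mul_le_mul_of_nonneg_right h2 (modeWeight_nonneg ξ)
    · have h0 : modeWeight 𝒟 0 (n : ℤ) ξ = 0 := by simp [modeWeight, hξ hmem]
      simp [h0]
  calc 4 * Real.pi ^ 2 * ((2 : ℝ) ^ n) ^ 2
        = ∫ ξ, 4 * Real.pi ^ 2 * ((2 : ℝ) ^ n) ^ 2 * modeWeight 𝒟 0 (n : ℤ) ξ := by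
        rw [integral_const_mul, integral_modeWeight two_pos', mul_one]
    _ ≤ viscRate 𝒟 n := integral_mono_ae ((integrable_modeWeight).const_mul _)
        (integrable_heatRate_mul_modeWeight two_pos') hle

/-- **`Λ_n ≤ Λ_{n+1}`**: the finer block dissipates faster (`(3/2)² ≤ 4`). [folklore] -/
theorem viscRate_le_viscRate_succ (n : ℕ) : viscRate 𝒟 n ≤ viscRate 𝒟 (n + 1) := by
  have h1 := viscRate_le 𝒟 n
  have h2 := sq_le_viscRate 𝒟 (n + 1)
  have h3 : ((2 : ℝ) ^ n * (3 / 2)) ^ 2 ≤ ((2 : ℝ) ^ (n + 1)) ^ 2 := by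
    have h2n : (2 : ℝ) ^ (n + 1) = 2 ^ n * 2 := pow_succ 2 n
    rw [h2n]; nlinarith [sq_nonneg ((2 : ℝ) ^ n)]
  linarith [mul_le_mul_of_nonneg_left h3 (by positivity : (0 : ℝ) ≤ 4 * Real.pi ^ 2)]

end Visc

/-! ### §2. The pinned field is the viscously damped gate -/

section Pair

variable (𝒟 : CascadeWaveletData 1 1) (S : CascadeSpecs)

/-- **`υ • nsVF n = pairVF (υΛ_n) (υΛ_{n+1}) η (υ E_n κ_n/√E_{n+1}) (υ √E_n κ'_n)`** for every
clock `υ` and every readout point (the closed form `nsVF_eq`, regrouped; `η = E_{n+1}/E_n`).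
[folklore] -/
theorem smul_nsVF_eq_pairVF (n : ℕ) (υ : ℝ) (p : ℝ × ℝ) :
    υ • nsVF 𝒟 S n p = pairVF (υ * viscRate 𝒟 n) (υ * viscRate 𝒟 (n + 1)) S.eta
      (υ * S.Emin n * fwdCoef 𝒟 n / Real.sqrt (S.Emin (n + 1)))
      (υ * Real.sqrt (S.Emin n) * backCoef 𝒟 n) p := by
  rw [nsVF_eq]
  obtain ⟨s, hs, hsE⟩ : ∃ s : ℝ, 0 < s ∧ Real.sqrt (S.Emin n) = s := ⟨_, sqrt_Emin_pos S n, rfl⟩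
  obtain ⟨t, ht, htE⟩ : ∃ t : ℝ, 0 < t ∧ Real.sqrt (S.Emin (n + 1)) = t :=
    ⟨_, sqrt_Emin_pos S (n + 1), rfl⟩
  have hEn : S.Emin n = s ^ 2 := by rw [← hsE, Real.sq_sqrt (S.Emin_pos n).le]
  have hEm : S.Emin (n + 1) = t ^ 2 := by rw [← htE, Real.sq_sqrt (S.Emin_pos (n + 1)).le]
  have hη : S.eta = t ^ 2 / s ^ 2 := by
    rw [eq_div_iff (pow_pos hs 2).ne', ← hEn, ← hEm, S.Emin_succ]
  simp only [pairVF, Prod.smul_mk, smul_eq_mul, Prod.mk.injEq]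
  rw [hsE, htE, hEn, hEm, hη]
  constructor
  · field_simp
  · field_simp


/-- **`κ'_n = 0`**: the backscatter coefficient of every admissible design vanishes
(`BlockPairSupport.re_eulerForm_mode_succ_succ_self`).
[cite: Tao2016AveragedNS, (1.3) + Lemma 4.1] -/
theorem backCoef_eq_zero (n : ℕ) : backCoef 𝒟 n = 0 :=
  re_eulerForm_mode_succ_succ_self 𝒟 n

/-- **`υ • nsVF n = pairVF (υΛ_n) (υΛ_{n+1}) η (υ E_n κ_n/√E_{n+1}) 0`** — the viscously damped
gate, no backscatter term. [folklore] -/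
theorem smul_nsVF_eq_pairVF_zero (n : ℕ) (υ : ℝ) (p : ℝ × ℝ) :
    υ • nsVF 𝒟 S n p = pairVF (υ * viscRate 𝒟 n) (υ * viscRate 𝒟 (n + 1)) S.eta
      (υ * S.Emin n * fwdCoef 𝒟 n / Real.sqrt (S.Emin (n + 1))) 0 p := by
  rw [smul_nsVF_eq_pairVF, backCoef_eq_zero, mul_zero]

end Pair

/-! ### §3. The viscous ceiling of the pinned field -/

section Ceiling

variable (𝒟 : CascadeWaveletData 1 1) (S : CascadeSpecs)

/-- **NO HAND-OFF AMPLITUDE AT A SUBCRITICAL BLOCK.** Along an exact orbit of `υ • nsVF n`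
(`υ > 0`) on `[0, T]` from a clean input `(A₀, 0)`, `A₀ > 0`, of a design with `κ_n > 0`: if
`E_n κ_n A₀ ≤ √E_{n+1} Λ_{n+1}` then `b(t) < A₀` for all `t ∈ [0, T]`. [folklore] -/
theorem nsVF_orbit_snd_lt_of_subcritical (n : ℕ) {υ T : ℝ} (hυ : 0 < υ) (hκ : 0 < fwdCoef 𝒟 n)
    {z : ℝ → ℝ × ℝ}
    (hsub : S.Emin n * fwdCoef 𝒟 n * (z 0).1 ≤ Real.sqrt (S.Emin (n + 1)) * viscRate 𝒟 (n + 1))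
    (hcont : ContinuousOn z (Icc 0 T))
    (hderiv : ∀ t ∈ Ico 0 T, HasDerivWithinAt z (υ • nsVF 𝒟 S n (z t)) (Ici t) t)
    (h0 : 0 < (z 0).1) (h0' : (z 0).2 = 0) : ∀ t ∈ Icc 0 T, (z t).2 < (z 0).1 := by
  set k : ℝ := υ * S.Emin n * fwdCoef 𝒟 n / Real.sqrt (S.Emin (n + 1)) with hk
  have hderiv' : ∀ x ∈ Ico 0 T, HasDerivWithinAt z
      (pairVF (υ * viscRate 𝒟 n) (υ * viscRate 𝒟 (n + 1)) S.eta k 0 (z x)) (Ici x) x :=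
    fun x hx => by rw [hk, ← smul_nsVF_eq_pairVF_zero]; exact hderiv x hx
  have ht := sqrt_Emin_pos S (n + 1)
  have hkpos : 0 < k := by
    rw [hk]; exact div_pos (mul_pos (mul_pos hυ (S.Emin_pos n)) hκ) ht
  have hΛ₁ : 0 ≤ υ * viscRate 𝒟 n := (mul_pos hυ (viscRate_pos 𝒟 n)).le
  have hΛ₂ : 0 < υ * viscRate 𝒟 (n + 1) := mul_pos hυ (viscRate_pos 𝒟 (n + 1))
  have hsub' : k * (z 0).1 ≤ υ * viscRate 𝒟 (n + 1) := by
    rw [hk, div_mul_eq_mul_div, div_le_iff₀ ht]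
    have h1 := mul_le_mul_of_nonneg_left hsub hυ.le
    nlinarith [h1]
  exact pair_snd_lt_of_subcritical hΛ₁ hΛ₂ S.eta_pos.le hkpos le_rfl hsub' hcont hderiv' h0 h0'

end Ceiling

/-! ### §4. No reach certificate on any open region at a subcritical block -/

variable {𝒟 : CascadeWaveletData 1 1} {S : CascadeSpecs} {P : Params S}
variable {F : ℝ × ℝ → ℝ × ℝ} {U : Set (ℝ × ℝ)} {ε : ℝ}

/-- **NO REACH CERTIFICATE ON ANY OPEN REGION AT A SUBCRITICAL BLOCK.** If the design has
`κ_n > 0` and `E_n κ_n aLo ≤ √E_{n+1} Λ_{n+1}` at some block `n`, then an inhabited residue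
`OpenReachBound 𝒟 P F U ε` on an OPEN working region `U` (necessarily `AinO P ⊆ U`, by
`Tube_zero` / `Tube_sub`; no output ray needed), a reach certificate
`ReachCertificate F U ε 1 (AinO P) (AoutO P)`, and an exact orbit of the pinned field
`unit n • nsVF n` over one tick from the clean admissible input `(aLo, 0)` cannot coexist,
WHATEVER `F`, `U` AND `ε` ARE: rigidity pins `F` within `ε` of `unit n • nsVF n` on `U`, so the
orbit is certified (`cert_exists_mem`) to reach output amplitude `≥ aLo`; by the viscous ceiling
it never does. [folklore] -/
theorem OpenReachBound.no_certificate_of_subcritical (H : OpenReachBound 𝒟 P F U ε)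
    (hU : IsOpen U) (c : ReachCertificate F U ε 1 (AinO P) (AoutO P)) (n : ℕ)
    (hκ : 0 < fwdCoef 𝒟 n)
    (hsub : S.Emin n * fwdCoef 𝒟 n * P.aLo ≤ Real.sqrt (S.Emin (n + 1)) * viscRate 𝒟 (n + 1))
    {z : ℝ → ℝ × ℝ} (hzc : Continuous z) (hz0 : z 0 = (P.aLo, 0))
    (hzd : ∀ σ ∈ Ico (0 : ℝ) 1, HasDerivWithinAt z (H.unit n • nsVF 𝒟 S n (z σ)) (Ici σ) σ) :
    False := by
  have hp : ((P.aLo, (0 : ℝ)) : ℝ × ℝ) ∈ AinO P := mem_AinO_base (by linarith [P.δ_pos])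
  obtain ⟨σ, hσ, hσout⟩ := cert_exists_mem c hU zero_le_one hp hz0 hzc (fun σ hσ' hσU =>
    ⟨H.unit n • nsVF 𝒟 S n (z σ), hzd σ hσ', H.norm_unit_smul_nsVF_sub_le n hσU⟩)
  have hout : P.aLo ≤ (z σ).2 := (Set.mem_prod.1 hσout).2
  have h0 : 0 < (z 0).1 := by rw [hz0]; exact lt_of_lt_of_le one_pos P.one_le_aLo
  have h0' : (z 0).2 = 0 := by rw [hz0]
  have hsub0 : S.Emin n * fwdCoef 𝒟 n * (z 0).1 ≤
      Real.sqrt (S.Emin (n + 1)) * viscRate 𝒟 (n + 1) := by rw [hz0]; exact hsub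
  have hlt := nsVF_orbit_snd_lt_of_subcritical 𝒟 S n (H.unit_pos n) hκ hsub0 hzc.continuousOn
    hzd h0 h0' σ hσ
  rw [hz0] at hlt
  exact absurd hout (not_le.2 hlt)

/-- The same, as emptiness of the certificate type: at a subcritical block whose pinned two-mode
orbit from `(aLo, 0)` exists over one tick, an inhabited residue on an open `U` leaves NO reach
certificate `AinO → AoutO` for its own `F, U, ε`. [folklore] -/
theorem OpenReachBound.isEmpty_certificate_of_subcritical (H : OpenReachBound 𝒟 P F U ε)
    (hU : IsOpen U) (n : ℕ) (hκ : 0 < fwdCoef 𝒟 n)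
    (hsub : S.Emin n * fwdCoef 𝒟 n * P.aLo ≤ Real.sqrt (S.Emin (n + 1)) * viscRate 𝒟 (n + 1))
    {z : ℝ → ℝ × ℝ} (hzc : Continuous z) (hz0 : z 0 = (P.aLo, 0))
    (hzd : ∀ σ ∈ Ico (0 : ℝ) 1, HasDerivWithinAt z (H.unit n • nsVF 𝒟 S n (z σ)) (Ici σ) σ) :
    IsEmpty (ReachCertificate F U ε 1 (AinO P) (AoutO P)) :=
  ⟨fun c => H.no_certificate_of_subcritical hU c n hκ hsub hzc hz0 hzd⟩

/-- **NON-VACUITY of the subcritical hypothesis**: it holds at block `n` as soon as the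
floor energy `E_n` is small against `√E_{n+1} Λ_{n+1}/(κ_n aLo)` — in particular for every design
and every `aLo` there are spec sheets meeting it (recorded as the trivial real inequality it is;
the spec sheet enters only through the three displayed numbers). [folklore] -/
theorem subcritical_of_le {E E' Λ κ a : ℝ} (hκ : 0 < κ) (ha : 0 < a)
    (hE : E ≤ Real.sqrt E' * Λ / (κ * a)) : E * κ * a ≤ Real.sqrt E' * Λ := by
  rw [le_div_iff₀ (mul_pos hκ ha)] at hE
  linarith [hE]

end BlockDesign

end Summit.NavierStokesRegularity.FluidComputer

end
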